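import Literature.Probability.LatticeModels.PlaneRotatorLiebRivasseauProof
import HarnessLib

/-!
# Lieb's separating inequality with a general inside system, and exponential decay from a uniform
# shell bound (Simon's iteration with a floor-distance)

E. H. Lieb, *A refinement of Simon's correlation inequality*, Comm. Math. Phys. **77** (1980) 127–135
[Lieb1980]. The separating inequality (23) — in the tree the theorem `PlaneRotator.liebRivasseauInequality_holds`
(`PlaneRotatorLiebRivasseauProof.lean`; V. Rivasseau, Comm. Math. Phys. **77** (1980) 145 [Rivasseau1980] for
general inside systems) — is applied in `PlaneRotatorLiebRivasseauInequality.lean` / `PlaneRotatorLiebCriterion.lean`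
with the STAR of a site as inside system (Lieb's Theorem 4). Lieb's point (abstract and p. 128 of the reprint:
"`φ(β) < 1` for some `β` implies exponential decay ... one can, in principle, compute `β_c` to arbitrary accuracy
by taking `B` to be the boundary of a sufficiently large box") is that ANY inside system works (with B. Simon,
Comm. Math. Phys. **77** (1980) 111, Thm 1.3 [Simon1980CMP]: subharmonicity ⇒ decay). This file is the abstract
half of that "finite algorithm", on an arbitrary finite vertex set, in the vocabulary of
`PlaneRotatorGinibreComparison.lean` (`twoPoint J a b = ⟨cos(θ_a − θ_b)⟩_{V,J}`, couplings `J ≥ 0` on ordered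
pairs, inverse temperature absorbed); the lattice half (boxes in `ℤ^ν`, Lieb's number `S_R`) is
`PlaneRotatorLiebBoxCriterion.lean`.

* `insideCoupling J A S` — Lieb's inside Hamiltonian `H_A` for a region `A` with SHELL `S ⊆ A`: the bonds of `J`
  with both ends in `A`, the shell–shell bonds removed ("It is immaterial whether the `B` spins are connected
  together, for any such interaction can be regarded as part of `H_C`", p. 133 — removing them sharpens the
  criterion, by Griffiths–Ginibre).
* `twoPoint_le_sum_shell` — **(23) with a general inside system**: if no bond of `J` joins the interior `A ∖ S`
  to the outside of `A`, then for `x ∈ A` and `c` outside the interior,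
  `⟨σ_x·σ_c⟩ ≤ ∑_{b ∈ S} ⟨σ_x·σ_b⟩_A ⟨σ_b·σ_c⟩`.
* `decay_of_shellBound`, `twoPoint_le_pow_of_shell_rowSum_le` — Simon's iteration with a floor-distance:
  regions `A_x ∋ x` with shells `S_x`, shell row sums `∑_{b ∈ S_x} ⟨σ_x·σ_b⟩_{A_x} ≤ s`, and an `ℕ`-valued `d` with
  `d(x) ≤ d(b) + 1` for `b ∈ S_x` and `d(x) ≥ 1 ⇒ c ∉ A_x ∖ S_x` give `⟨σ_a·σ_c⟩ ≤ s^{d(a)}`.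
* `twoPoint_restrict_eq`, `twoPoint_le_of_injOn` — a system supported in `A × A` is the system on the vertex
  set `A`; comparison with any dominating reference system under a map injective on `A` (Griffiths–Ginibre,
  tree `twoPoint_le_of_embedding`) — the step that bounds the shell row sums of all partial boxes by ONE number.

Cell use (`pub/hubbard-tc`, MO-S3, ASSUMPTIONS §1 key K5): see `PlaneRotatorLiebBoxCriterion.lean`. Classical
rotators only; no `T_c` object.
-/

noncomputable section

open MeasureTheory Finset
open scoped BigOperators

namespace Literature.Probability.LatticeModels

namespace PlaneRotator

/-! ### Inside systems with a separating shell: Lieb's (23) for general regions -/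

section Inside

variable {V : Type} [Fintype V] [DecidableEq V] [MeasurableSpace Circle] [BorelSpace Circle]

/-- **Lieb's inside Hamiltonian** of a region `A` with shell `S`: the couplings of `J` with both ends in `A`,
except the shell–shell ones (which are "regarded as part of `H_C`"). [cite: Lieb1980, eqs. (4)–(5) and p. 133 (B–B interactions part of H_C)] -/
def insideCoupling (J : V × V → ℝ) (A S : Finset V) : V × V → ℝ :=
  fun p => if p.1 ∈ A ∧ p.2 ∈ A ∧ ¬(p.1 ∈ S ∧ p.2 ∈ S) then J p else 0

omit [Fintype V] [MeasurableSpace Circle] [BorelSpace Circle] in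
/-- The inside couplings are non-negative when `J` is (ferromagnetic inside Hamiltonian). [cite: Lieb1980, eqs. (4)–(5) and p. 132 (J_{ab} ≥ 0)] -/
theorem insideCoupling_nonneg {J : V × V → ℝ} (hJ : ∀ p, 0 ≤ J p) (A S : Finset V) (p : V × V) :
    0 ≤ insideCoupling J A S p := by
  unfold insideCoupling; split_ifs <;> [exact hJ p; exact le_rfl]

omit [Fintype V] [MeasurableSpace Circle] [BorelSpace Circle] in
/-- The inside couplings are dominated by `J` (for `J ≥ 0`): `H_A` is a sub-Hamiltonian of `H_{A+C}`. [cite: Lieb1980, eqs. (4)–(5) (H_{A+C} = H_A + H_C)] -/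
theorem insideCoupling_le {J : V × V → ℝ} (hJ : ∀ p, 0 ≤ J p) (A S : Finset V) (p : V × V) :
    insideCoupling J A S p ≤ J p := by
  unfold insideCoupling; split_ifs <;> [exact le_rfl; exact hJ p]

omit [Fintype V] [MeasurableSpace Circle] [BorelSpace Circle] in
/-- The inside couplings are supported in `A × A` (`H_A` involves the `A` spins only). [cite: Lieb1980, eqs. (4)–(5) (H_A)] -/
theorem insideCoupling_support (J : V × V → ℝ) (A S : Finset V) (p : V × V)
    (hp : insideCoupling J A S p ≠ 0) : p.1 ∈ A ∧ p.2 ∈ A := by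
  unfold insideCoupling at hp
  split_ifs at hp with h
  · exact ⟨h.1, h.2.1⟩
  · exact absurd rfl hp

omit [Fintype V] [MeasurableSpace Circle] [BorelSpace Circle] in
/-- Off the shell–shell pairs, the inside coupling of a pair in `A × A` is `J`. [cite: Lieb1980, eqs. (4)–(5) and p. 133 (B–B interactions part of H_C)] -/
theorem insideCoupling_of_mem {J : V × V → ℝ} {A S : Finset V} {p : V × V} (h1 : p.1 ∈ A) (h2 : p.2 ∈ A)
    (hS : ¬(p.1 ∈ S ∧ p.2 ∈ S)) : insideCoupling J A S p = J p := by
  unfold insideCoupling; rw [if_pos ⟨h1, h2, hS⟩]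

omit [Fintype V] [MeasurableSpace Circle] [BorelSpace Circle] in
/-- On shell–shell pairs the inside coupling vanishes (those bonds are put into `H_C`). [cite: Lieb1980, p. 133 (B–B interactions regarded as part of H_C)] -/
theorem insideCoupling_of_shell {J : V × V → ℝ} {A S : Finset V} {p : V × V} (h1 : p.1 ∈ S) (h2 : p.2 ∈ S) :
    insideCoupling J A S p = 0 := by
  unfold insideCoupling; rw [if_neg (fun h => h.2.2 ⟨h1, h2⟩)]

/-- **Lieb's inequality (23) with a general inside system** (Lieb 1980 for stars, Rivasseau 1980 in general;
tree theorem `liebRivasseauInequality_holds`). Let `J ≥ 0`, `S ⊆ A`, and suppose no bond of `J` joins the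
interior `A ∖ S` to the complement of `A` (every bond leaving `A` starts on the shell). Then for `x ∈ A` and every
`c` not in the interior (`c ∈ A → c ∈ S`):

  `⟨cos(θ_x − θ_c)⟩_J ≤ ∑_{b ∈ S} ⟨cos(θ_x − θ_b)⟩_{inside(A,S)} · ⟨cos(θ_b − θ_c)⟩_J`

— the instance `H_A` = inside couplings, `C = (V ∖ A) ∪ S`, `B = A ∩ C = S` of (23).
[cite: Lieb1980, eq. (23) and notes added in proof (2); Rivasseau1980, Theorem] -/
theorem twoPoint_le_sum_shell {J : V × V → ℝ} (hJ : ∀ p, 0 ≤ J p) {A S : Finset V} (hSA : S ⊆ A)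
    (hrange : ∀ p, J p ≠ 0 → (p.1 ∈ A → p.2 ∉ A → p.1 ∈ S) ∧ (p.2 ∈ A → p.1 ∉ A → p.2 ∈ S))
    {x c : V} (hx : x ∈ A) (hc : c ∈ A → c ∈ S) :
    twoPoint J x c ≤ ∑ b ∈ S, twoPoint (insideCoupling J A S) x b * twoPoint J b c := by
  classical
  set JA : V × V → ℝ := insideCoupling J A S with hJA
  set JC : V × V → ℝ := J - JA with hJC
  set C : Finset V := Finset.univ.filter fun v => v ∉ A ∨ v ∈ S with hCdef
  have hsum : JA + JC = J := by simp [hJC]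
  have hAC : A ∩ C = S := by
    ext v
    simp only [hCdef, Finset.mem_inter, Finset.mem_filter, Finset.mem_univ, true_and]
    constructor
    · rintro ⟨hvA, hv | hv⟩
      · exact absurd hvA hv
      · exact hv
    · exact fun hv => ⟨hSA hv, Or.inr hv⟩
  have hJA0 : ∀ p, 0 ≤ JA p := insideCoupling_nonneg hJ A S
  have hJC_eval : ∀ p, JC p = if p.1 ∈ A ∧ p.2 ∈ A ∧ ¬(p.1 ∈ S ∧ p.2 ∈ S) then 0 else J p := by
    intro p
    simp only [hJC, Pi.sub_apply, hJA, insideCoupling]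
    split_ifs <;> ring
  have hJC0 : ∀ p, 0 ≤ JC p := fun p => by
    rw [hJC_eval]; split_ifs <;> [exact le_rfl; exact hJ p]
  have hAsupp : ∀ p, JA p ≠ 0 → p.1 ∈ A ∧ p.2 ∈ A := insideCoupling_support J A S
  have hCsupp : ∀ p, JC p ≠ 0 → p.1 ∈ C ∧ p.2 ∈ C := by
    intro p hp
    rw [hJC_eval] at hp
    have hcond : ¬(p.1 ∈ A ∧ p.2 ∈ A ∧ ¬(p.1 ∈ S ∧ p.2 ∈ S)) := fun h => hp (if_pos h)
    rw [if_neg hcond] at hp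
    obtain ⟨h1, h2⟩ := hrange p hp
    simp only [hCdef, Finset.mem_filter, Finset.mem_univ, true_and]
    by_cases ha : p.1 ∈ A <;> by_cases hb : p.2 ∈ A
    · have hS : p.1 ∈ S ∧ p.2 ∈ S := by
        by_contra hS; exact hcond ⟨ha, hb, hS⟩
      exact ⟨Or.inr hS.1, Or.inr hS.2⟩
    · exact ⟨Or.inr (h1 ha hb), Or.inl hb⟩
    · exact ⟨Or.inl ha, Or.inr (h2 hb ha)⟩
    · exact ⟨Or.inl ha, Or.inl hb⟩
  have hcC : c ∈ C := by
    simp only [hCdef, Finset.mem_filter, Finset.mem_univ, true_and]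
    by_cases hcA : c ∈ A
    · exact Or.inr (hc hcA)
    · exact Or.inl hcA
  have key := liebRivasseauInequality_holds V A C JA JC hJA0 hJC0 hAsupp hCsupp x hx c hcC
  rwa [hsum, hAC] at key

end Inside

/-! ### Simon's iteration with a floor-distance: decay from a uniform shell bound -/

section Decay

variable {V : Type} [Fintype V]

/-- **Decay from shell subharmonicity** (Simon 1980 Thm 1.3 / Lieb 1980 p. 128, finite form with a
floor-distance). Let `G ≤ 1`, `K ≥ 0` with row sums `≤ s`, `G(x) ≤ ∑_y K(x,y) G(y)` whenever `d(x) ≠ 0`, and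
`K(x,y) ≠ 0 ⇒ d(x) ≤ d(y) + 1`. Then `G(x) ≤ s^{d(x)}` for every `x`. (Induction on `n` for
`G ≤ max(s^{d}, s^{n})`.) [cite: Simon1980CMP, Thm 1.3; Lieb1980, p. 128 (φ(β) < 1 implies exponential decay)] -/
theorem decay_of_shellBound {G : V → ℝ} {K : V → V → ℝ} {s : ℝ} {d : V → ℕ} (hG1 : ∀ x, G x ≤ 1)
    (hK : ∀ x y, 0 ≤ K x y) (hrow : ∀ x, ∑ y, K x y ≤ s)
    (hsub : ∀ x, d x ≠ 0 → G x ≤ ∑ y, K x y * G y) (hd : ∀ x y, K x y ≠ 0 → d x ≤ d y + 1) (x : V) :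
    G x ≤ s ^ d x := by
  have hs0 : 0 ≤ s := (Finset.sum_nonneg fun y _ => hK x y).trans (hrow x)
  by_cases hs1 : s ≤ 1
  swap
  · exact (hG1 x).trans (one_le_pow₀ (not_le.1 hs1).le)
  -- `P n : ∀ z, G z ≤ max (s ^ d z) (s ^ n)` by induction on `n`
  have hP : ∀ n : ℕ, ∀ z, G z ≤ max (s ^ d z) (s ^ n) := by
    intro n
    induction n with
    | zero => exact fun z => (hG1 z).trans (by rw [pow_zero]; exact le_max_right _ _)
    | succ n ih =>
      intro z
      by_cases hdz : d z = 0
      · rw [hdz, pow_zero]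
        exact (hG1 _).trans (le_max_left _ _)
      have hdz1 : 1 ≤ d z := Nat.one_le_iff_ne_zero.2 hdz
      set m : ℝ := max (s ^ (d z - 1)) (s ^ n) with hm
      have hm0 : 0 ≤ m := le_max_of_le_right (pow_nonneg hs0 n)
      -- termwise: `K z y · G y ≤ K z y · m`
      have hterm : ∀ y, K z y * G y ≤ K z y * m := by
        intro y
        by_cases hKy : K z y = 0
        · rw [hKy, zero_mul, zero_mul]
        refine mul_le_mul_of_nonneg_left ((ih y).trans (max_le_max ?_ le_rfl)) (hK z y)
        have hdy : d z - 1 ≤ d y := by have := hd z y hKy; omega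
        exact pow_le_pow_of_le_one hs0 hs1 hdy
      calc G z ≤ ∑ y, K z y * G y := hsub z hdz
        _ ≤ ∑ y, K z y * m := Finset.sum_le_sum fun y _ => hterm y
        _ = (∑ y, K z y) * m := by rw [Finset.sum_mul]
        _ ≤ s * m := mul_le_mul_of_nonneg_right (hrow z) hm0
        _ = max (s ^ d z) (s ^ (n + 1)) := by
            rw [hm, mul_max_of_nonneg _ _ hs0, ← pow_succ', ← pow_succ', Nat.sub_add_cancel hdz1]
  have h := hP (d x) x
  rwa [max_self] at h

variable [DecidableEq V] [MeasurableSpace Circle] [BorelSpace Circle]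

/-- **Lieb's criterion with general inside systems** (the "finite algorithm", finite-volume form). Let `J ≥ 0`;
for every site `x` let `A_x ∋ x` be a region with shell `S_x ⊆ A_x` such that every bond of `J` leaving `A_x`
starts on `S_x`; suppose the shell row sums are uniformly bounded,
`∑_{b ∈ S_x} ⟨cos(θ_x − θ_b)⟩_{inside(A_x,S_x)} ≤ s`. Let `d : V → ℕ` satisfy `d(x) ≤ d(b) + 1` for `b ∈ S_x`, and
`d(x) ≠ 0 ⇒` (`c ∈ A_x → c ∈ S_x`). Then `⟨cos(θ_a − θ_c)⟩_J ≤ s^{d(a)}` for every `a` — exponential decay with the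
same rate in every volume as soon as `s < 1`. [cite: Lieb1980, eq. (23) with p. 128 (boxes; finite algorithm); Simon1980CMP, Thm 1.3] -/
theorem twoPoint_le_pow_of_shell_rowSum_le {J : V × V → ℝ} (hJ : ∀ p, 0 ≤ J p) (A S : V → Finset V)
    (hSA : ∀ x, S x ⊆ A x) (hxA : ∀ x, x ∈ A x)
    (hrange : ∀ x p, J p ≠ 0 →
      (p.1 ∈ A x → p.2 ∉ A x → p.1 ∈ S x) ∧ (p.2 ∈ A x → p.1 ∉ A x → p.2 ∈ S x))
    {s : ℝ} (hrow : ∀ x, ∑ b ∈ S x, twoPoint (insideCoupling J (A x) (S x)) x b ≤ s)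
    (c : V) {d : V → ℕ} (hdc : ∀ x, d x ≠ 0 → c ∈ A x → c ∈ S x)
    (hd : ∀ x, ∀ b ∈ S x, d x ≤ d b + 1) (a : V) :
    twoPoint J a c ≤ s ^ d a := by
  classical
  set K : V → V → ℝ := fun x b =>
    if b ∈ S x then twoPoint (insideCoupling J (A x) (S x)) x b else 0 with hK
  have hK0 : ∀ x b, 0 ≤ K x b := fun x b => by
    simp only [hK]
    split_ifs
    · exact twoPoint_nonneg (insideCoupling_nonneg hJ _ _) _ _
    · exact le_rfl
  refine decay_of_shellBound (G := fun y => twoPoint J y c) (K := K) (fun y => twoPoint_le_one J y c) hK0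
    (fun x => ?_) (fun x hx => ?_) (fun x b hb => ?_) a
  · -- row sums
    simp only [hK]
    rw [Finset.sum_ite_mem, Finset.univ_inter]
    exact hrow x
  · -- the shell inequality (23)
    refine (twoPoint_le_sum_shell hJ (hSA x) (hrange x) (hxA x) (hdc x hx)).trans (le_of_eq ?_)
    simp only [hK, ite_mul, zero_mul]
    rw [Finset.sum_ite_mem, Finset.univ_inter]
  · -- the kernel only charges the shell
    have hbS : b ∈ S x := by
      by_contra h
      exact hb (by simp only [hK, if_neg h])
    exact hd x b hbS

end Decay

/-! ### Restriction to the support and comparison with a reference system -/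

section Compare

variable {V W : Type} [Fintype V] [Fintype W] [MeasurableSpace Circle] [BorelSpace Circle]

omit [Fintype V] [MeasurableSpace Circle] [BorelSpace Circle] in
/-- A coupling array supported in `A × A` is the zero extension (`extendCoupling`) of its restriction to the
vertex set `A`. [folklore] -/
private theorem extendCoupling_restrict_eq {J : V × V → ℝ} {A : Finset V} (hJA : ∀ p, J p ≠ 0 → p.1 ∈ A ∧ p.2 ∈ A) :
    extendCoupling (Subtype.val : A → V) (fun q : A × A => J ((q.1 : V), (q.2 : V))) = J := by
  classical
  funext p
  unfold extendCoupling
  by_cases hp : ∃ q : A × A, Prod.map Subtype.val Subtype.val q = p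
  · obtain ⟨q, rfl⟩ := hp
    rw [(Subtype.val_injective.prodMap Subtype.val_injective).extend_apply]
    rfl
  · rw [Function.extend_apply' _ _ _ hp, Pi.zero_apply]
    by_contra h
    obtain ⟨h1, h2⟩ := hJA p (Ne.symm h)
    exact hp ⟨(⟨p.1, h1⟩, ⟨p.2, h2⟩), rfl⟩

/-- **Restriction to the support.** If `J` is supported in `A × A`, the two-point function between points of
`A` is that of the system on the vertex set `A` alone (the other rotators are free and integrate out; tree
`twoPoint_extend_eq`). [cite: Ginibre1970, Example 4 with Prop. 3 (plane rotators; subsystem at zero coupling)] -/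
theorem twoPoint_restrict_eq {J : V × V → ℝ} {A : Finset V} (hJA : ∀ p, J p ≠ 0 → p.1 ∈ A ∧ p.2 ∈ A)
    {a b : V} (ha : a ∈ A) (hb : b ∈ A) :
    twoPoint (fun q : A × A => J ((q.1 : V), (q.2 : V))) ⟨a, ha⟩ ⟨b, hb⟩ = twoPoint J a b := by
  have h := twoPoint_extend_eq (V := V) (S := A) Subtype.val_injective
    (fun q : A × A => J ((q.1 : V), (q.2 : V))) ⟨a, ha⟩ ⟨b, hb⟩
  rw [extendCoupling_restrict_eq hJA] at h
  exact h.symm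

/-- **Comparison with a reference system** (Griffiths–Ginibre). Let `J ≥ 0` be supported in `A × A`, `τ : V → W`
injective on `A`, and `J_ref ≥ 0` a coupling array on `W` dominating `J` along `τ` on `A`:
`J(y,z) ≤ J_ref(τy, τz)` for `y, z ∈ A`. Then `⟨cos(θ_a − θ_b)⟩_{V,J} ≤ ⟨cos(θ_{τa} − θ_{τb})⟩_{W,J_ref}` for
`a, b ∈ A` (restriction to `A`, then the tree's embedding comparison `twoPoint_le_of_embedding`).
[cite: Ginibre1970, Prop. 3 with Example 4 (plane rotators)] -/
theorem twoPoint_le_of_injOn {J : V × V → ℝ} (hJ : ∀ p, 0 ≤ J p) {A : Finset V}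
    (hJA : ∀ p, J p ≠ 0 → p.1 ∈ A ∧ p.2 ∈ A) (τ : V → W) (hτ : Set.InjOn τ A)
    {Jref : W × W → ℝ} (hJref : ∀ p, 0 ≤ Jref p)
    (hdom : ∀ y ∈ A, ∀ z ∈ A, J (y, z) ≤ Jref (τ y, τ z)) {a b : V} (ha : a ∈ A) (hb : b ∈ A) :
    twoPoint J a b ≤ twoPoint Jref (τ a) (τ b) := by
  rw [← twoPoint_restrict_eq hJA ha hb]
  have hinj : Function.Injective fun u : A => τ (u : V) :=
    fun u v huv => Subtype.ext (hτ u.2 v.2 huv)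
  exact twoPoint_le_of_embedding (τ := fun u : A => τ (u : V)) hinj
    (J₀ := fun q : A × A => J ((q.1 : V), (q.2 : V))) (fun _ => hJ _) hJref
    (fun y z => hdom y y.2 z z.2) ⟨a, ha⟩ ⟨b, hb⟩

end Compare

end PlaneRotator

end Literature.Probability.LatticeModels

end
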